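import Literature.AlgebraicGeometry.ModuliOfAbelianVarieties.SiegelFineModuliSchemeClassifyCoequal
import Literature.AlgebraicGeometry.AbelianSchemes.PolarizedAbelianSchemeWithLevelBaseChangeUnique
import Literature.AlgebraicGeometry.AbelianSchemes.LevelStructureTransportIso
import Literature.AlgebraicGeometry.AbelianSchemes.AbelianSchemeOverZariskiGluingHom
import Literature.AlgebraicGeometry.AbelianSchemes.PolarizationLevelBaseQuotientDescent
import Literature.AlgebraicGeometry.AbelianSchemes.PolarizedLevelChange
import HarnessLib

/-!
# On the kernel pair of a refining cover the classifying map coequalises after the twist-killed quotient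
# ([MFK94] Ch. 7 §3 pp. 139–142; [Deligne 1971] 4.16; [Lan 2013] Rem. 1.4.1.9)

Topic `AlgebraicGeometry/ModuliOfAbelianVarieties`; namespace
`Literature.AlgebraicGeometry.ModuliOfAbelianVarieties.SiegelFineModuliScheme`.  THEOREMS ONLY (no definition, no named
fact, no instance, no notation, no `sorry`; net Literature debt 0).  Cell hodgecm-mathlib (D-0151), F-DAG leaf F-10 (b)
«`classify` for the quotient `M/Γ`», brick (b2) TRANSPORT + KERNEL PAIR over ★ (b2) CORE
`SiegelFineModuliSchemeClassifyCoequal` (`classifyingMap_left_comp_eq_of_changeLevel_eq`: two symplectic-liftable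
refinements of one level-`N₀` structure on ONE polarised abelian scheme have `p`-equal classifying maps for every
`p : M → Q` killed by the twist operators of `K_δ(N₀)`).  Here the «one abelian scheme» hypothesis is removed: it
suffices that the level-`N₀` reductions of two level-`N` triples be pull-backs of one triple along the same map (§1,
transport along the comparison isomorphism of ★ `PolarizedAbelianSchemeWithLevelBaseChangeUnique`, ★
`LevelStructure.exists_comp_of_iso`, liftability by ★ `LevelStructure.isSymplecticLiftable_of_isBaseChangeVia`), which
is the situation on the kernel pair `T′ ×_T T′ ⇉ T′` of a cover along which a level-`N₀` triple was refined to level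
`N` (§2) — [MumfordFogartyKirwan1994] Ch. 7 §3, the descent mechanism of pp. 139–142 («`Γ` acts on `𝒜_{g,d,n}`, hence
on `A_{g,d,n}`», the quotient recovers the lower level); [Lan2013PELCompactifications] Rem. 1.4.1.9 / Cor. 1.4.1.12
(the moduli problems at two neat levels differ by a finite étale quotient).  What remains for (b2′) downstream: the
quotient `p : M → M/Γ` with the invariance `hp` (★ finite-quotient files) and the descent of `f′ ≫ p` along the cover
(★ `MorphismExtensionFpqcDescent`).  HC_CM is proved only modulo the 7 printed citations until rung 0 closes; this
file discharges none of them (count-neutral capital).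

* §1 `classifyingMap_left_comp_eq_of_changeLevel_isBaseChangeVia` — `P₁`, `P₂` level-`N` triples over `T` with
  `(Pᵢ.changeLevel N₀).IsBaseChangeVia Y q Gᵢ Ĝᵢ` (same `Y`, same `q`) ⇒ `(classifyingMap P₁).left ≫ p = (classifyingMap P₂).left ≫ p`.
* §2 **`comp_classifyingMap_left_comp_eq_of_comp_eq`** — for `x₁, x₂ : X → T′` with `x₁ ≫ c = x₂ ≫ c` and `P′` over
  `T′` refining the pull-back of `Y` along `c`: `(x₁ ≫ classifyingMap P′).left ≫ p = (x₂ ≫ classifyingMap P′).left ≫ p`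
  (★ `PolarizedAbelianSchemeWithLevel.baseChange`, ★ `IsBaseChangeVia.changeLevel` / `.trans`, Mathlib
  `Functor.isCommMonObj_obj` for the commutativity of the pulled-back group scheme).
* §3 **`existsUnique_desc_classifyingMap_left_comp`** — for an fpqc cover `c : T′ → T` locally of finite type (e.g.
  finite étale surjective): `∃! f : T → Q, c ≫ f = classifyingMap P′ ≫ p` (Mathlib `EffectiveEpi.desc` — surjective +
  flat + quasi-compact morphisms of schemes are effective epimorphisms — applied to §2 on the kernel pair
  `T′ ×_T T′`, locally Noetherian by Mathlib `LocallyOfFiniteType.isLocallyNoetherian`).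
* §4 `twist_left_comp_eq_of_forall_inv_left_comp_eq` — the hypothesis `hp` of §§1–3 for every `p` invariant under
  the action `ρ : K_δ(1) → Aut M` of ★ `SiegelFineModuliScheme.exists_principalLevelSubgroup_one_action` restricted to
  `K_δ(N₀)` (so the quotient `M → M/Γ`, `Γ = ρ(K_δ(N₀))`, qualifies).

Mathlib searched (pin): `Over.isoMk`, `asIso`, `Functor.isCommMonObj_obj`, `EffectiveEpi.desc/fac/uniq`,
`LocallyOfFiniteType.isLocallyNoetherian`, `pullback.lift_fst/snd` (all used).

## References
* D. Mumford, J. Fogarty, F. Kirwan, *Geometric Invariant Theory*, 3rd ed. (1994), Ch. 7 §3 (pp. 139–140; the proof of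
  Thm. 7.10, pp. 140–142). [MumfordFogartyKirwan1994]
* P. Deligne, *Travaux de Shimura*, Sém. Bourbaki 389 (1971), 4.16 p. 150. [Deligne1971TravauxShimura]
* U. Görtz, T. Wedhorn, *Algebraic Geometry I*, 2nd ed. (2020), Thm. 14.72 (descent of morphisms along fpqc covers).
  [GortzWedhorn2020]
* K.-W. Lan, *Arithmetic compactifications of PEL-type Shimura varieties* (2013), §1.4.1 Remark 1.4.1.9 (p. 90).
  [Lan2013PELCompactifications]
-/

noncomputable section

open CategoryTheory CategoryTheory.Limits AlgebraicGeometry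
open scoped MonObj

namespace Literature.AlgebraicGeometry.ModuliOfAbelianVarieties

open Literature.AlgebraicGeometry.Motives (SchemeOver)
open Literature.AlgebraicGeometry.AbelianSchemes (PolarizedAbelianSchemeWithLevel)
open Literature.AlgebraicGeometry.AbelianSchemes.AbelianSchemeOver
open Literature.NumberTheory.Adeles NumberField IsDedekindDomain
open MonoidalCategory
open scoped MonObj

namespace SiegelFineModuliScheme

variable {g N : ℕ} {δ : Fin g → ℕ} (𝓜 : SiegelFineModuliScheme g N δ) [IsCommMonObj 𝓜.univ.A.X] [NeZero N]

/-! ### §1 Two level-`N` triples with isomorphic level-`N₀` reductions -/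

/-- **TWO LEVEL-`N` TRIPLES WHOSE LEVEL-`N₀` REDUCTIONS ARE PULL-BACKS OF ONE TRIPLE ALONG THE SAME MAP HAVE THE SAME
CLASSIFYING MAP AFTER EVERY MORPHISM KILLED BY THE TWIST OPERATORS OF `K_δ(N₀)`** ([MumfordFogartyKirwan1994] Ch. 7 §3
pp. 139–142; [Deligne1971TravauxShimura] 4.16).  The comparison isomorphism `(H, Ĥ)` of the two level-`N₀` pull-backs
(★ `IsBaseChangeVia.exists_isBaseChangeVia_id_of_isBaseChangeVia`) is an isomorphism of polarised abelian schemes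
over `T`; transporting the level-`N` structure of `P₂` along it (★ `LevelStructure.exists_comp_of_iso`, liftability by
★ `LevelStructure.isSymplecticLiftable_of_isBaseChangeVia`) gives a second symplectic-liftable level-`N` structure
`η₂′` on `P₁.A` with `classifyingMap (P₁.A, P₁.pol, η₂′) = classifyingMap P₂` (★ `classifyingMap_comp` along `𝟙 T`)
and the SAME level-`N₀` reduction as `P₁.level`; conclude by ★ `classifyingMap_left_comp_eq_of_changeLevel_eq`.
[cite: MumfordFogartyKirwan1994, Ch. 7 §3 (pp. 139–140)] [cite: Deligne1971TravauxShimura, 4.16 p. 150] -/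
theorem classifyingMap_left_comp_eq_of_changeLevel_isBaseChangeVia (hδ : IsPolarizationType δ) (hg : 0 < g)
    {N₀ d : ℕ} [NeZero N₀] (hd : N = N₀ * d) (T : SchemeOver ℚ) [IsLocallyNoetherian T.left]
    (P₁ P₂ : PolarizedAbelianSchemeWithLevel g N δ T.left) [IsCommMonObj P₁.A.X]
    {S₀ : Scheme} {Y : PolarizedAbelianSchemeWithLevel g N₀ δ S₀} {q : T.left ⟶ S₀}
    {G₁ : P₁.A.X.left ⟶ Y.A.X.left} {Ĝ₁ : P₁.D.hat.X.left ⟶ Y.D.hat.X.left}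
    {G₂ : P₂.A.X.left ⟶ Y.A.X.left} {Ĝ₂ : P₂.D.hat.X.left ⟶ Y.D.hat.X.left}
    (h₁ : (P₁.changeLevel N₀ d hd (NeZero.ne N)).IsBaseChangeVia Y q G₁ Ĝ₁)
    (h₂ : (P₂.changeLevel N₀ d hd (NeZero.ne N)).IsBaseChangeVia Y q G₂ Ĝ₂)
    {Q : Scheme} (p : 𝓜.M.left ⟶ Q)
    (hp : ∀ r : gspFinAdelic δ, r ∈ principalLevelSubgroup δ N₀ → ∀ GN : GL (Fin g ⊕ Fin g) (ZMod N),
      (∀ (i j : Fin g ⊕ Fin g)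
        (h : ((r : GL (Fin g ⊕ Fin g) finAdeleQ) : Matrix (Fin g ⊕ Fin g) (Fin g ⊕ Fin g) finAdeleQ) i j ∈
          FiniteAdeleRing.integralAdeles (𝓞 ℚ) ℚ),
        (GN : Matrix (Fin g ⊕ Fin g) (Fin g ⊕ Fin g) (ZMod N)) i j = integralAdeleResidue N ⟨_, h⟩) →
      ∀ hs : (𝓜.univ.level.twist GN).IsSymplecticLiftable 𝓜.univ.pol δ,
        (haveI := 𝓜.isLocallyNoetherian
         (𝓜.classifyingMap 𝓜.M ({ 𝓜.univ with level := 𝓜.univ.level.twist GN, symplectic := hs } :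
           PolarizedAbelianSchemeWithLevel g N δ 𝓜.M.left)).left) ≫ p = p) :
    (𝓜.classifyingMap T P₁).left ≫ p = (𝓜.classifyingMap T P₂).left ≫ p := by
  haveI := 𝓜.isLocallyNoetherian
  -- the comparison isomorphism of the two level-`N₀` pull-backs
  obtain ⟨H, Ĥ, hH, -, -, -, hU⟩ := h₁.exists_isBaseChangeVia_id_of_isBaseChangeVia h₂
  obtain ⟨⟨hA, hσ₀⟩, hhat, ⟨wG, wĜ, ⟨eP⟩⟩, hlam⟩ := hU
  -- read the clauses on `P₁`, `P₂` themselves (`changeLevel` keeps `A`, `D`, `pol`)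
  have hA' : P₂.A.IsBaseChangeVia P₁.A (𝟙 T.left) H := hA
  have hhat' : P₂.D.hat.IsBaseChangeVia P₁.D.hat (𝟙 T.left) Ĥ := hhat
  have hlam' : P₂.pol.lam.left ≫ Ĥ = H ≫ P₁.pol.lam.left := hlam
  have wG' : P₂.A.X.hom ≫ 𝟙 T.left = H ≫ P₁.A.X.hom := wG
  have wĜ' : P₂.D.hat.X.hom ≫ 𝟙 T.left = Ĥ ≫ P₁.D.hat.X.hom := wĜ
  have eP' : Nonempty ((Scheme.Modules.pullback (pullback.map P₂.A.X.hom P₂.D.hat.X.hom P₁.A.X.hom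
      P₁.D.hat.X.hom H Ĥ (𝟙 T.left) wG' wĜ')).obj P₁.D.P ≅ P₂.D.P) := ⟨eP⟩
  have hσ₀' : ∀ i, (P₂.level.σ i ^ d).left ≫ H = 𝟙 T.left ≫ (P₁.level.σ i ^ d).left := hσ₀
  -- `H` as an isomorphism of `T`-group schemes `P₂.A ≅ P₁.A`
  have wH : H ≫ P₁.A.X.hom = P₂.A.X.hom := by
    have w := wG'
    rw [Category.comp_id] at w
    exact w.symm
  obtain ⟨e, he⟩ : ∃ e : P₂.A.X ≅ P₁.A.X, e.hom.left = H := ⟨Over.isoMk (@asIso _ _ _ _ H hH) wH, rfl⟩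
  haveI : IsMonHom e.hom := isMonHom_of_isBaseChangeVia_id e.hom (he ▸ hA')
  -- transport the level-`N` structure of `P₂` to `P₁.A`
  obtain ⟨η₂', hη₂'⟩ := LevelStructure.exists_comp_of_iso e P₂.level
  have hσ : ∀ i, (P₂.level.σ i).left ≫ H = 𝟙 T.left ≫ (η₂'.σ i).left := fun i => by
    rw [hη₂', Over.comp_left, he, Category.id_comp]
    rfl
  -- symplectic-liftability moves along the isomorphism of triples
  have hs₂' : η₂'.IsSymplecticLiftable P₁.pol δ :=
    LevelStructure.isSymplecticLiftable_of_isBaseChangeVia hA' P₂.D P₁.D hhat' P₂.level η₂' hσ P₂.pol P₁.pol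
      hlam' eP' δ P₂.symplectic
  -- `P₂` is the pull-back of `(P₁.A, P₁.pol, η₂')` along `𝟙 T`: same classifying map
  have hrel : P₂.IsBaseChangeVia ({ P₁ with level := η₂', symplectic := hs₂' } :
      PolarizedAbelianSchemeWithLevel g N δ T.left) (𝟙 T.left) H Ĥ :=
    ⟨⟨hA', hσ⟩, hhat', ⟨wG', wĜ', eP'⟩, hlam'⟩
  have e12 : 𝓜.classifyingMap T ({ P₁ with level := η₂', symplectic := hs₂' } :
      PolarizedAbelianSchemeWithLevel g N δ T.left) = 𝓜.classifyingMap T P₂ := by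
    have h := 𝓜.classifyingMap_comp (𝟙 T) _ P₂ hrel
    rwa [Category.id_comp] at h
  -- the level-`N₀` reductions of `P₁.level` and `η₂'` coincide
  have hη : P₁.level.changeLevel N₀ d hd (NeZero.ne N) = η₂'.changeLevel N₀ d hd (NeZero.ne N) := by
    refine LevelStructure.ext_σ (funext fun i => ?_)
    ext
    have h0 := hσ₀' i
    rw [Category.id_comp] at h0
    rw [LevelStructure.changeLevel_σ, LevelStructure.changeLevel_σ, hη₂', ← MonObj.pow_comp, Over.comp_left, he]
    exact h0.symm
  rw [← e12]
  exact 𝓜.classifyingMap_left_comp_eq_of_changeLevel_eq hδ hg hd T P₁ η₂' hs₂' hη p hp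

/-! ### §2 The kernel pair of a refining cover -/

/-- **ON THE KERNEL PAIR OF A REFINING COVER THE CLASSIFYING MAP COEQUALISES AFTER `p`** ([MumfordFogartyKirwan1994]
Ch. 7 §3 pp. 139–142, the descent step of `A_{g,δ,N} → A_{g,δ,N₀}`; [Lan2013PELCompactifications] Rem. 1.4.1.9,
Cor. 1.4.1.12).  Let `P′` be a level-`N` triple over `T′` whose level-`N₀` reduction is a pull-back of a triple `Y` over
`S₀` along `c : T′ → S₀`, and let `x₁, x₂ : X → T′` be two morphisms of locally Noetherian `ℚ`-schemes with
`x₁ ≫ c = x₂ ≫ c` (e.g. the two projections of `T′ ×_{S₀} T′`).  Then `x₁ ≫ classifyingMap P′` and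
`x₂ ≫ classifyingMap P′` agree after every `p : M → Q` killed by the twist operators of `K_δ(N₀)`: both pull-backs
`xᵢ^* P′` have level-`N₀` reductions that are pull-backs of `Y` along the common composite, and §1 applies.
[cite: MumfordFogartyKirwan1994, Ch. 7 §3 (pp. 139–140)] [cite: Lan2013PELCompactifications, §1.4.1 Remark 1.4.1.9 (p. 90)] -/
theorem comp_classifyingMap_left_comp_eq_of_comp_eq (hδ : IsPolarizationType δ) (hg : 0 < g)
    {N₀ d : ℕ} [NeZero N₀] (hd : N = N₀ * d) {T' X : SchemeOver ℚ} [IsLocallyNoetherian T'.left]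
    [IsLocallyNoetherian X.left] (P' : PolarizedAbelianSchemeWithLevel g N δ T'.left) [IsCommMonObj P'.A.X]
    {S₀ : Scheme} {Y : PolarizedAbelianSchemeWithLevel g N₀ δ S₀} {c : T'.left ⟶ S₀}
    {G : P'.A.X.left ⟶ Y.A.X.left} {Ĝ : P'.D.hat.X.left ⟶ Y.D.hat.X.left}
    (hY : (P'.changeLevel N₀ d hd (NeZero.ne N)).IsBaseChangeVia Y c G Ĝ)
    (x₁ x₂ : X ⟶ T') (hx : x₁.left ≫ c = x₂.left ≫ c)
    {Q : Scheme} (p : 𝓜.M.left ⟶ Q)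
    (hp : ∀ r : gspFinAdelic δ, r ∈ principalLevelSubgroup δ N₀ → ∀ GN : GL (Fin g ⊕ Fin g) (ZMod N),
      (∀ (i j : Fin g ⊕ Fin g)
        (h : ((r : GL (Fin g ⊕ Fin g) finAdeleQ) : Matrix (Fin g ⊕ Fin g) (Fin g ⊕ Fin g) finAdeleQ) i j ∈
          FiniteAdeleRing.integralAdeles (𝓞 ℚ) ℚ),
        (GN : Matrix (Fin g ⊕ Fin g) (Fin g ⊕ Fin g) (ZMod N)) i j = integralAdeleResidue N ⟨_, h⟩) →
      ∀ hs : (𝓜.univ.level.twist GN).IsSymplecticLiftable 𝓜.univ.pol δ,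
        (haveI := 𝓜.isLocallyNoetherian
         (𝓜.classifyingMap 𝓜.M ({ 𝓜.univ with level := 𝓜.univ.level.twist GN, symplectic := hs } :
           PolarizedAbelianSchemeWithLevel g N δ 𝓜.M.left)).left) ≫ p = p) :
    (x₁ ≫ 𝓜.classifyingMap T' P').left ≫ p = (x₂ ≫ 𝓜.classifyingMap T' P').left ≫ p := by
  -- the two pull-backs of `P'` to `X`
  let P₁ : PolarizedAbelianSchemeWithLevel g N δ X.left := P'.baseChange x₁.left
  let P₂ : PolarizedAbelianSchemeWithLevel g N δ X.left := P'.baseChange x₂.left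
  haveI : IsCommMonObj P₁.A.X :=
    ⟨(Functor.isCommMonObj_obj (F := Over.pullback x₁.left) (M := P'.A.X)).mul_comm⟩
  have w₁ := P'.baseChange_isBaseChangeVia x₁.left
  have w₂ := P'.baseChange_isBaseChangeVia x₂.left
  rw [𝓜.classifyingMap_comp x₁ P' P₁ w₁, 𝓜.classifyingMap_comp x₂ P' P₂ w₂]
  -- their level-`N₀` reductions are pull-backs of `Y` along the common composite
  have h₁ := (w₁.changeLevel N₀ d hd (NeZero.ne N)).trans hY
  have h₂ := (w₂.changeLevel N₀ d hd (NeZero.ne N)).trans hY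
  rw [← hx] at h₂
  exact 𝓜.classifyingMap_left_comp_eq_of_changeLevel_isBaseChangeVia hδ hg hd X P₁ P₂ h₁ h₂ p hp

/-! ### §3 Descent along the refining cover -/

/-- **CLASSIFY THROUGH THE QUOTIENT: EXISTENCE AND UNIQUENESS OF THE DESCENDED MAP** ([MumfordFogartyKirwan1994] Ch. 7
§3 pp. 139–142; [Lan2013PELCompactifications] Rem. 1.4.1.9).  Let `c : T′ → T` be an fpqc cover (surjective, flat,
quasi-compact) locally of finite type of `ℚ`-schemes, `T′` locally Noetherian, and `P′` a level-`N` triple over `T′`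
whose level-`N₀` reduction is the pull-back along `c` of a triple `Y` over `T`.  Then for every `p : M → Q` killed by the
twist operators of `K_δ(N₀)` the morphism `classifyingMap P′ ≫ p : T′ → Q` descends UNIQUELY along `c`: effective
descent of morphisms (Mathlib `EffectiveEpi.desc`; `c` is an effective epimorphism) applied to §2 on the kernel pair
`T′ ×_T T′` (locally Noetherian: a base change of `c` is locally of finite type), through which every pair
`g₁, g₂ : Z → T′` with `g₁ ≫ c = g₂ ≫ c` factors. [cite: MumfordFogartyKirwan1994, Ch. 7 §3 (pp. 139–140)]
[cite: GortzWedhorn2020, Thm. 14.72] [cite: Lan2013PELCompactifications, §1.4.1 Remark 1.4.1.9 (p. 90)] -/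
theorem existsUnique_desc_classifyingMap_left_comp (hδ : IsPolarizationType δ) (hg : 0 < g)
    {N₀ d : ℕ} [NeZero N₀] (hd : N = N₀ * d) {T T' : SchemeOver ℚ} [IsLocallyNoetherian T'.left]
    (c : T' ⟶ T) [Surjective c.left] [Flat c.left] [QuasiCompact c.left] [LocallyOfFiniteType c.left]
    (P' : PolarizedAbelianSchemeWithLevel g N δ T'.left) [IsCommMonObj P'.A.X]
    {Y : PolarizedAbelianSchemeWithLevel g N₀ δ T.left}
    {G : P'.A.X.left ⟶ Y.A.X.left} {Ĝ : P'.D.hat.X.left ⟶ Y.D.hat.X.left}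
    (hY : (P'.changeLevel N₀ d hd (NeZero.ne N)).IsBaseChangeVia Y c.left G Ĝ)
    {Q : Scheme} (p : 𝓜.M.left ⟶ Q)
    (hp : ∀ r : gspFinAdelic δ, r ∈ principalLevelSubgroup δ N₀ → ∀ GN : GL (Fin g ⊕ Fin g) (ZMod N),
      (∀ (i j : Fin g ⊕ Fin g)
        (h : ((r : GL (Fin g ⊕ Fin g) finAdeleQ) : Matrix (Fin g ⊕ Fin g) (Fin g ⊕ Fin g) finAdeleQ) i j ∈
          FiniteAdeleRing.integralAdeles (𝓞 ℚ) ℚ),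
        (GN : Matrix (Fin g ⊕ Fin g) (Fin g ⊕ Fin g) (ZMod N)) i j = integralAdeleResidue N ⟨_, h⟩) →
      ∀ hs : (𝓜.univ.level.twist GN).IsSymplecticLiftable 𝓜.univ.pol δ,
        (haveI := 𝓜.isLocallyNoetherian
         (𝓜.classifyingMap 𝓜.M ({ 𝓜.univ with level := 𝓜.univ.level.twist GN, symplectic := hs } :
           PolarizedAbelianSchemeWithLevel g N δ 𝓜.M.left)).left) ≫ p = p) :
    ∃! f : T.left ⟶ Q, c.left ≫ f = (𝓜.classifyingMap T' P').left ≫ p := by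
  -- the kernel pair of `c`, a locally Noetherian `ℚ`-scheme with its two projections to `T'`
  let K : Scheme := pullback c.left c.left
  haveI : IsLocallyNoetherian K := LocallyOfFiniteType.isLocallyNoetherian (pullback.fst c.left c.left)
  let Kℚ : SchemeOver ℚ := Over.mk (pullback.fst c.left c.left ≫ T'.hom)
  haveI : IsLocallyNoetherian Kℚ.left := inferInstanceAs (IsLocallyNoetherian K)
  let x₁ : Kℚ ⟶ T' := Over.homMk (pullback.fst c.left c.left) rfl
  let x₂ : Kℚ ⟶ T' := Over.homMk (pullback.snd c.left c.left) (by
    change pullback.snd c.left c.left ≫ T'.hom = pullback.fst c.left c.left ≫ T'.hom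
    rw [← Over.w c, ← Category.assoc, ← pullback.condition, Category.assoc])
  have hK : pullback.fst c.left c.left ≫ ((𝓜.classifyingMap T' P').left ≫ p) =
      pullback.snd c.left c.left ≫ ((𝓜.classifyingMap T' P').left ≫ p) := by
    have h := 𝓜.comp_classifyingMap_left_comp_eq_of_comp_eq hδ hg hd P' hY x₁ x₂ pullback.condition p hp
    simp only [Over.comp_left, Category.assoc] at h
    exact h
  -- every pair coequalised by `c` factors through the kernel pair
  have hco : ∀ {Z : Scheme} (g₁ g₂ : Z ⟶ T'.left), g₁ ≫ c.left = g₂ ≫ c.left →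
      g₁ ≫ ((𝓜.classifyingMap T' P').left ≫ p) = g₂ ≫ ((𝓜.classifyingMap T' P').left ≫ p) := by
    intro Z g₁ g₂ hg
    rw [← pullback.lift_fst g₁ g₂ hg, Category.assoc, hK, ← Category.assoc, pullback.lift_snd]
  refine ⟨EffectiveEpi.desc c.left _ hco, EffectiveEpi.fac c.left _ hco, fun f hf => ?_⟩
  exact EffectiveEpi.uniq c.left _ hco f hf

/-! ### §4 The hypothesis `hp` from an invariant morphism -/

/-- **The hypothesis `hp` of §§1–3 holds for every morphism invariant under the action of `K_δ(N₀)`**: if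
`ρ : K_δ(1) → Aut M` acts through the twist operators of a reduction homomorphism `red` with residue entries (the
data of ★ `SiegelFineModuliScheme.exists_principalLevelSubgroup_one_action`) and `p : M → Q` satisfies
`(ρ γ)⁻¹ ≫ p = p` for all `γ ∈ K_δ(N₀)`, then `p` is killed by the twist operator of every reduction `γ̄` of every
`γ ∈ K_δ(N₀)` (a matrix with the residue entries of `γ` IS `red γ`; the liftability witness is irrelevant).
[cite: MumfordFogartyKirwan1994, Ch. 7 §3 (p. 140)] [cite: Deligne1971TravauxShimura, 4.16 p. 150] -/
theorem twist_left_comp_eq_of_forall_inv_left_comp_eq {N₀ : ℕ}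
    (red : principalLevelSubgroup δ 1 →* GL (Fin g ⊕ Fin g) (ZMod N)) (ρ : principalLevelSubgroup δ 1 →* Aut 𝓜.M)
    (hred : ∀ (k : principalLevelSubgroup δ 1) (i j : Fin g ⊕ Fin g)
      (h : (((k : gspFinAdelic δ) : GL (Fin g ⊕ Fin g) finAdeleQ) :
        Matrix (Fin g ⊕ Fin g) (Fin g ⊕ Fin g) finAdeleQ) i j ∈ FiniteAdeleRing.integralAdeles (𝓞 ℚ) ℚ),
      ((red k : GL (Fin g ⊕ Fin g) (ZMod N)) : Matrix (Fin g ⊕ Fin g) (Fin g ⊕ Fin g) (ZMod N)) i j =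
        integralAdeleResidue N ⟨_, h⟩)
    (hρ : ∀ k : principalLevelSubgroup δ 1, ∃ hs : (𝓜.univ.level.twist (red k)).IsSymplecticLiftable 𝓜.univ.pol δ,
      (ρ k).inv = (haveI := 𝓜.isLocallyNoetherian
        𝓜.classifyingMap 𝓜.M ({ 𝓜.univ with level := 𝓜.univ.level.twist (red k), symplectic := hs } :
          PolarizedAbelianSchemeWithLevel g N δ 𝓜.M.left)))
    {Q : Scheme} (p : 𝓜.M.left ⟶ Q)
    (hinv : ∀ k : principalLevelSubgroup δ 1, (k : gspFinAdelic δ) ∈ principalLevelSubgroup δ N₀ →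
      (ρ k).inv.left ≫ p = p) :
    ∀ r : gspFinAdelic δ, r ∈ principalLevelSubgroup δ N₀ → ∀ GN : GL (Fin g ⊕ Fin g) (ZMod N),
      (∀ (i j : Fin g ⊕ Fin g)
        (h : ((r : GL (Fin g ⊕ Fin g) finAdeleQ) : Matrix (Fin g ⊕ Fin g) (Fin g ⊕ Fin g) finAdeleQ) i j ∈
          FiniteAdeleRing.integralAdeles (𝓞 ℚ) ℚ),
        (GN : Matrix (Fin g ⊕ Fin g) (Fin g ⊕ Fin g) (ZMod N)) i j = integralAdeleResidue N ⟨_, h⟩) →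
      ∀ hs : (𝓜.univ.level.twist GN).IsSymplecticLiftable 𝓜.univ.pol δ,
        (haveI := 𝓜.isLocallyNoetherian
         (𝓜.classifyingMap 𝓜.M ({ 𝓜.univ with level := 𝓜.univ.level.twist GN, symplectic := hs } :
           PolarizedAbelianSchemeWithLevel g N δ 𝓜.M.left)).left) ≫ p = p := by
  haveI := 𝓜.isLocallyNoetherian
  intro r hr GN hGN hs
  let k : principalLevelSubgroup δ 1 := ⟨r, principalLevelSubgroup_anti δ (one_dvd N₀) hr⟩
  -- a matrix with the residue entries of `γ` is `red k`
  have hG : GN = red k := by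
    refine Units.ext (Matrix.ext fun i j => ?_)
    have hint := isIntegral_of_isCongOne_one ((mem_principalLevelSubgroup_iff δ).1 k.2).1 i j
    rw [hGN i j hint, hred k i j hint]
  subst hG
  obtain ⟨hs', hργ⟩ := hρ k
  have hirr : (𝓜.classifyingMap 𝓜.M ({ 𝓜.univ with level := 𝓜.univ.level.twist (red k), symplectic := hs } :
      PolarizedAbelianSchemeWithLevel g N δ 𝓜.M.left)) = (ρ k).inv := hργ.symm
  rw [hirr]
  exact hinv k hr

end SiegelFineModuliScheme

end Literature.AlgebraicGeometry.ModuliOfAbelianVarieties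

end
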